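import Summits.BirchSwinnertonDyer.Rank1Residual.Additive.X4MThreeUpperHalfTowerFree
import HarnessLib

/-!
# X4 ∧ `r = 0`, every odd `p`: the (M) chain and the COVERED LOCUS WITHOUT the Wuthrich-Lemma-20
# binder (cell `b2b-bsdres`, team n1011, seat p14, OWNERS row T-b1 kernel piece 3a;
# sequel of `Additive/X4MThreeUpperHalfTowerFree.lean`)

HONEST FRAMING (cell `b2b-bsdres`, run/shared/lean/b2b/bsd-rank1-residual/, verbatim in every
file): the goal of the cell is to DELETE the COMBINATION-SHAPED residual classes of the
Birch–Swinnerton-Dyer formula for ALL analytic-rank `≤ 1` elliptic curves over `ℚ` — "full BSD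
formula for every rank `≤ 1` curve in class `C`" assembled STRICTLY from published theorems — so
that the rank-`≤ 1` remainder becomes exactly the CONSTRUCTION-SHAPED classes, which are TYPED
(missing-input `Prop`s), NOT attempted. This is not "finishing BSD". Team n1011 (N10 / N11, the
additive block X4 ∧ `p = 3`): research route on the CONSTRUCTION-SHAPED class X4; no claim beyond the
stated classes; the label X4 is UNCHANGED by this file; nothing is booked. Theorems only (no
definition, no named fact minted; every published input is an explicit named-fact hypothesis).

## What this file proves

In additive-p1's every-odd-`p` (M) chain (`AdditivePotMult/RankZeroChiBranchThree.lean` §3,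
`…PrimeFacts.lean` §2) and in additive-p4's covered-locus file (`Additive/X4RankZeroCoveredLocus.lean`
§1–§2) the named fact `hL20 : Wuthrich2014.lemma20_surjective_threeAdic_of_semistable` (registry A9)
is used at ONE place only: the `3`-adic tower of the multiplicative twist model on the (M) rows at
`p = 3`. That use is a THEOREM now (`ClassX4M.towerSurj_twist_negThree_of_surj`, sibling file §1, from
lit-kato's p247422/p248058). This file re-assembles both chains WITHOUT `hL20` (suffix `_noL20`;
every other binder and every conclusion IDENTICAL to the originals):

* §1 `AdditivePotMult.ClassX4M.missingUpperBoundAt_rankZero_of_chiBranch_of_surj_of_odd_noL20`,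
  `….missingUpperBoundAt_rankZero_of_surj_noL20` (+ `bsdp…_of_shaAn_unit_noL20`, `…_of_lower_noL20`,
  `….missingInputAt_iff_lower_rankZero_of_surj_noL20`) — X4(M) ∧ `r_an = 0` ∧ surj(p), every odd `p`;
* §2 `Additive.X4RankZero.missingUpperBoundAt_of_facts_noL20`, `….missingPPartAt_iff_lower_of_facts_noL20`,
  `….bsdp_of_facts_of_lower_noL20`, `….bsdp_of_facts_of_shaAn_unit_noL20` — the covered locus
  [`ord_p j < 0` ∨ (tower ∧ `ord_p ∏ c_ℓ = ord_p c_p` ∧ Manin datum)] from the sharp Kato reading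
  `hKatoS`, Delbourgo Prop. 4 `hDel`, parametrisation data `hmodD`, Kato's half-eigen divisibility
  `hKatoχ`, GZK, modularity — SIX inputs where the originals had seven.

The END-STATE equivalences without `hL20` are the sibling file
`Additive/X4SharpUnitFreeResidueNoLemma20.lean`. Net registry effect: A9 has NO binder left in any
class-X4 theorem of record (its residual scope is the good-supersingular `3` of X10/X11/X6–X8).
X4 stays CONSTRUCTION-SHAPED; nothing booked.

References: Kato 2004 [Kato2004Asterisque] Thm. 14.5 (3) (p. 236), Thm. 17.4 (3) (p. 273);
Delbourgo 1998 [Delbourgo1998] Prop. 4 (p. 144); Wuthrich 2014 [Wuthrich2014] Lemma 20 (p. 399),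
Cor. 19 (p. 398); Miller 2011 [Miller2011LMS] Def. 1.1.
-/

noncomputable section

open scoped Classical

open WeierstrassCurve Literature.NumberTheory.EllipticCurves
  Literature.NumberTheory.EllipticCurves.ModularForms
  Literature.NumberTheory.EllipticCurves.Rank1Residual
  Literature.NumberTheory.EllipticCurves.Rank1Residual.Typed

/-! ### §1 X4(M) ∧ surj(p), every odd `p`, rank `0` — no `hL20` -/

namespace Summit.BirchSwinnertonDyer.Rank1Residual.AdditivePotMult

open Additive

variable {W : WeierstrassCurve ℚ} [W.IsElliptic] [W.IsGloballyMinimal] {p : ℕ} [hp : Fact p.Prime]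

/-- **X4(M) ∧ `r_an = 0` ∧ surj(p), ANY odd `p`: `Typed.MissingUpperBoundAt W p` from the typed
`χ_p`-branch inputs, with NO `ram`, NO Tamagawa, NO Manin AND NO `hL20` binder** — additive-p1's
`ClassX4M.missingUpperBoundAt_rankZero_of_chiBranch_of_surj_of_odd` with the `p = 3` case served by
`ClassX4M.missingUpperBoundAt_three_rankZero_of_chiBranch_of_surj'` (tower of the multiplicative twist
model a theorem) and the `p ≠ 3` case by the gen-6 theorem `…_of_chiBranch` (its `p = 3 → ram`
premise vacuous). [cite: Delbourgo1998, Prop. 4 (p. 144) and Lemma (ii) (p. 139)]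
[cite: Wuthrich2014, Lemma 20 (p. 399)] -/
theorem ClassX4M.missingUpperBoundAt_rankZero_of_chiBranch_of_surj_of_odd_noL20
    (hDel : Delbourgo1998.prop4_rankZero_pow_dvd_constantCoeff)
    (hGZK : rank_eq_analyticRank_of_analyticRank_le_one) (hmod : hasEntireLFunction_rat)
    (hmodD : nonempty_modularParametrizationData)
    (hBCeven : ChiBranchLeadingTermBigImageAt W p) (hBCodd : ChiBranchLeadingTermOddBigImageAt W p)
    (hX : ClassX4M W p) (hr : W.analyticRank = 0) (hsurj : Surj W p) :
    MissingUpperBoundAt W p := by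
  by_cases hp3 : p = 3
  · subst hp3
    exact ClassX4M.missingUpperBoundAt_three_rankZero_of_chiBranch_of_surj' hDel hGZK hmod hmodD
      hBCodd hX hr hsurj
  · exact ClassX4M.missingUpperBoundAt_rankZero_of_chiBranch hDel hGZK hmod hmodD hBCeven hBCodd hX hr
      hsurj fun h ↦ absurd h hp3

/-- **X4(M) ∧ `r_an(E) = 0` ∧ surj(p), ANY odd `p`: the upper half `ord_p #Ш(E) ≤ ord_p #Ш_an(E)`
from Delbourgo 1998 Prop. 4 (`hDel`), GZK, modularity (`hmod`, `hmodD`) and Kato's divisibility read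
on the `ω^{(p−1)/2}`-component over `ℚ(μ_{p^∞})` (`hKato`) — additive-p1's
`ClassX4M.missingUpperBoundAt_rankZero_of_surj` WITHOUT `hL20`.** NO `ram`, NO Tamagawa, NO Manin,
NO `j`-witness hypothesis. X4(M) stays CONSTRUCTION-SHAPED; nothing booked.
[cite: Delbourgo1998, Prop. 4 (p. 144) and Lemma (ii) (p. 139)] [cite: Wuthrich2014, Thm. 3 (p. 383), Cor. 19 (p. 398)]
[cite: Kato2004Asterisque, Thm. 17.4 (3) (p. 273)] -/
theorem ClassX4M.missingUpperBoundAt_rankZero_of_surj_noL20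
    (hDel : Delbourgo1998.prop4_rankZero_pow_dvd_constantCoeff)
    (hGZK : rank_eq_analyticRank_of_analyticRank_le_one) (hmod : hasEntireLFunction_rat)
    (hmodD : nonempty_modularParametrizationData)
    (hKato : Wuthrich2014.kato_halfEigenCharIdeal_dvd_cyclotomicPrime_of_surjective)
    (hX : ClassX4M W p) (hr : W.analyticRank = 0) (hsurj : Surj W p) : MissingUpperBoundAt W p :=
  ClassX4M.missingUpperBoundAt_rankZero_of_chiBranch_of_surj_of_odd_noL20 hDel hGZK hmod hmodD
    ((ClassX4M.potMult W p hX).chiBranchLeadingTermBigImageAt_of_halfFact hKato)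
    ((ClassX4M.potMult W p hX).chiBranchLeadingTermOddBigImageAt_of_halfFact hKato) hX hr hsurj

/-- **X4(M) ∧ `r_an(E) = 0` ∧ surj(p) ∧ `p ∤ #Ш_an(E)`, ANY odd `p`: `BSD(E,p)`** — `hL20`-free.
[cite: Delbourgo1998, Prop. 4 (p. 144)] [cite: Kato2004Asterisque, Thm. 17.4 (3) (p. 273)]
[cite: Miller2011LMS, §1 and Def. 1.1] -/
theorem ClassX4M.bsdp_rankZero_of_surj_of_shaAn_unit_noL20
    (hDel : Delbourgo1998.prop4_rankZero_pow_dvd_constantCoeff)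
    (hGZK : rank_eq_analyticRank_of_analyticRank_le_one) (hmod : hasEntireLFunction_rat)
    (hmodD : nonempty_modularParametrizationData)
    (hKato : Wuthrich2014.kato_halfEigenCharIdeal_dvd_cyclotomicPrime_of_surjective)
    (hX : ClassX4M W p) (hr : W.analyticRank = 0) (hsurj : Surj W p)
    {q : ℚ} (hq : shaAn W = (q : ℂ)) (hv : padicValRat p q = 0) : BSDp W p :=
  bsdp_of_missingPPartAt W p hGZK (by rw [hr]; exact zero_le_one)
    (missingPPartAt_of_upper_of_shaAn_unit W p
      (ClassX4M.missingUpperBoundAt_rankZero_of_surj_noL20 hDel hGZK hmod hmodD hKato hX hr hsurj) hq hv)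

/-- **X4(M) ∧ `r_an(E) = 0` ∧ surj(p), ANY odd `p`: `BSD(E,p)` from the LOWER half** — `hL20`-free.
[cite: Delbourgo1998, Prop. 4 (p. 144)] [cite: Kato2004Asterisque, Thm. 17.4 (3) (p. 273)]
[cite: Miller2011LMS, §1 and Def. 1.1] -/
theorem ClassX4M.bsdp_rankZero_of_surj_of_lower_noL20
    (hDel : Delbourgo1998.prop4_rankZero_pow_dvd_constantCoeff)
    (hGZK : rank_eq_analyticRank_of_analyticRank_le_one) (hmod : hasEntireLFunction_rat)
    (hmodD : nonempty_modularParametrizationData)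
    (hKato : Wuthrich2014.kato_halfEigenCharIdeal_dvd_cyclotomicPrime_of_surjective)
    (hX : ClassX4M W p) (hr : W.analyticRank = 0) (hsurj : Surj W p)
    (hlow : MissingLowerBoundAt W p) : BSDp W p :=
  bsdp_of_missingPPartAt W p hGZK (by rw [hr]; exact zero_le_one)
    (missingPPartAt_of_lower_of_upper W p hlow
      (ClassX4M.missingUpperBoundAt_rankZero_of_surj_noL20 hDel hGZK hmod hmodD hKato hX hr hsurj))

/-- **X4(M) ∧ `r_an(E) = 0` ∧ surj(p), ANY odd `p`: what remains of X4♯ is EXACTLY the lower half**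
— `hL20`-free. [cite: Delbourgo1998, Prop. 4 (p. 144)] [cite: Kato2004Asterisque, Thm. 17.4 (3) (p. 273)] -/
theorem ClassX4M.missingInputAt_iff_lower_rankZero_of_surj_noL20
    (hDel : Delbourgo1998.prop4_rankZero_pow_dvd_constantCoeff)
    (hGZK : rank_eq_analyticRank_of_analyticRank_le_one) (hmod : hasEntireLFunction_rat)
    (hmodD : nonempty_modularParametrizationData)
    (hKato : Wuthrich2014.kato_halfEigenCharIdeal_dvd_cyclotomicPrime_of_surjective)
    (hX : ClassX4M W p) (hr : W.analyticRank = 0) (hsurj : Surj W p) :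
    X4.MissingInputAt W p ↔ MissingLowerBoundAt W p :=
  ⟨fun h ↦ (lower_and_upper_of_missingPPartAt W p h).1, fun h ↦
    missingPPartAt_of_lower_of_upper W p h
      (ClassX4M.missingUpperBoundAt_rankZero_of_surj_noL20 hDel hGZK hmod hmodD hKato hX hr hsurj)⟩

end Summit.BirchSwinnertonDyer.Rank1Residual.AdditivePotMult

/-! ### §2 The covered locus, every odd `p` — no `hL20` -/

namespace Summit.BirchSwinnertonDyer.Rank1Residual.Additive

variable (W : WeierstrassCurve ℚ) [W.IsElliptic] [W.IsGloballyMinimal] (p : ℕ) [hp : Fact p.Prime]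

/-- **THE UPPER HALF ON THE COVERED LOCUS, every odd `p`, WITHOUT `hL20`**: X4 ∧ `r_an = 0` ∧
surj(p) ∧ [`ord_p j < 0` ∨ (`ρ̄_{E,p^n}` onto ∀ `n` ∧ `ord_p ∏ c_ℓ = ord_p c_p` ∧ ∃ datum `D` with
`p ∤ c_D`)] ⟹ `ord_p #Ш(E) ≤ ord_p #Ш_an(E)` — additive-p4's `X4RankZero.missingUpperBoundAt_of_facts`
with the (M) branch served by §1. Inputs: sharp Kato reading `hKatoS`, Delbourgo Prop. 4 `hDel`,
`hmodD`, Kato half-eigen `hKatoχ`, GZK, modularity. [cite: Kato2004Asterisque, Thm. 14.5 (3) (p. 236), Thm. 17.4 (3) (p. 273)]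
[cite: Delbourgo1998, Prop. 4 (p. 144)] [cite: Miller2011LMS, Def. 1.1] -/
theorem X4RankZero.missingUpperBoundAt_of_facts_noL20
    (hKatoS : Kato2004.rankZero_padicValNat_sha_le_sub_localTamagawa_of_additive_potGood_of_imageContainsSL2)
    (hDel : Delbourgo1998.prop4_rankZero_pow_dvd_constantCoeff)
    (hGZK : rank_eq_analyticRank_of_analyticRank_le_one) (hmod : hasEntireLFunction_rat)
    (hmodD : nonempty_modularParametrizationData)
    (hKatoχ : Wuthrich2014.kato_halfEigenCharIdeal_dvd_cyclotomicPrime_of_surjective)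
    (hr : W.analyticRank = 0) (hX : ClassX4 W p) (hsurj : Surj W p)
    (hcov : padicValRat p W.j < 0 ∨
      ((∀ n : ℕ, W.HasSurjectiveModNGaloisRep (p ^ n : ℕ)) ∧
        padicValNat p W.tamagawaProduct =
          padicValNat p ((W.baseChange ℚ_[p]).localTamagawaNumber ℤ_[p]) ∧
        ∃ (N : ℕ) (_ : NeZero N) (D : ModularParametrizationData W N), ¬ (p : ℤ) ∣ D.maninConstant)) :
    MissingUpperBoundAt W p := by
  by_cases hj : padicValRat p W.j < 0
  · exact AdditivePotMult.ClassX4M.missingUpperBoundAt_rankZero_of_surj_noL20 hDel hGZK hmod hmodD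
      hKatoχ ⟨hX, hX.2.1, hj⟩ hr hsurj
  · obtain ⟨htower, htam, N, hN, D, hc⟩ := hcov.resolve_left hj
    haveI := hN
    exact X4RankZero.missingUpperBoundAt_of_katoSharp W p hKatoS hGZK hmod hr hX (not_lt.mp hj)
      htower htam D hc

/-- **On the covered locus the typed input is EXACTLY the lower half**, every odd `p`, no `hL20`.
[cite: Kato2004Asterisque, Thm. 14.5 (3) (p. 236)] [cite: Delbourgo1998, Prop. 4 (p. 144)]
[cite: Miller2011LMS, Def. 1.1] -/
theorem X4RankZero.missingPPartAt_iff_lower_of_facts_noL20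
    (hKatoS : Kato2004.rankZero_padicValNat_sha_le_sub_localTamagawa_of_additive_potGood_of_imageContainsSL2)
    (hDel : Delbourgo1998.prop4_rankZero_pow_dvd_constantCoeff)
    (hGZK : rank_eq_analyticRank_of_analyticRank_le_one) (hmod : hasEntireLFunction_rat)
    (hmodD : nonempty_modularParametrizationData)
    (hKatoχ : Wuthrich2014.kato_halfEigenCharIdeal_dvd_cyclotomicPrime_of_surjective)
    (hr : W.analyticRank = 0) (hX : ClassX4 W p) (hsurj : Surj W p)
    (hcov : padicValRat p W.j < 0 ∨
      ((∀ n : ℕ, W.HasSurjectiveModNGaloisRep (p ^ n : ℕ)) ∧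
        padicValNat p W.tamagawaProduct =
          padicValNat p ((W.baseChange ℚ_[p]).localTamagawaNumber ℤ_[p]) ∧
        ∃ (N : ℕ) (_ : NeZero N) (D : ModularParametrizationData W N), ¬ (p : ℤ) ∣ D.maninConstant)) :
    MissingPPartAt W p ↔ MissingLowerBoundAt W p :=
  ⟨fun h ↦ (lower_and_upper_of_missingPPartAt W p h).1, fun h ↦
    missingPPartAt_of_lower_of_upper W p h
      (X4RankZero.missingUpperBoundAt_of_facts_noL20 W p hKatoS hDel hGZK hmod hmodD hKatoχ hr hX hsurj
        hcov)⟩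

/-- **`BSD(E,p)` on the covered locus from the LOWER half alone**, every odd `p`, no `hL20`.
[cite: Kato2004Asterisque, Thm. 14.5 (3) (p. 236)] [cite: Delbourgo1998, Prop. 4 (p. 144)]
[cite: Miller2011LMS, §1 and Def. 1.1] -/
theorem X4RankZero.bsdp_of_facts_of_lower_noL20
    (hKatoS : Kato2004.rankZero_padicValNat_sha_le_sub_localTamagawa_of_additive_potGood_of_imageContainsSL2)
    (hDel : Delbourgo1998.prop4_rankZero_pow_dvd_constantCoeff)
    (hGZK : rank_eq_analyticRank_of_analyticRank_le_one) (hmod : hasEntireLFunction_rat)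
    (hmodD : nonempty_modularParametrizationData)
    (hKatoχ : Wuthrich2014.kato_halfEigenCharIdeal_dvd_cyclotomicPrime_of_surjective)
    (hr : W.analyticRank = 0) (hX : ClassX4 W p) (hsurj : Surj W p)
    (hcov : padicValRat p W.j < 0 ∨
      ((∀ n : ℕ, W.HasSurjectiveModNGaloisRep (p ^ n : ℕ)) ∧
        padicValNat p W.tamagawaProduct =
          padicValNat p ((W.baseChange ℚ_[p]).localTamagawaNumber ℤ_[p]) ∧
        ∃ (N : ℕ) (_ : NeZero N) (D : ModularParametrizationData W N), ¬ (p : ℤ) ∣ D.maninConstant))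
    (hlow : MissingLowerBoundAt W p) : BSDp W p :=
  bsdp_of_missingPPartAt W p hGZK (by rw [hr]; exact zero_le_one)
    ((X4RankZero.missingPPartAt_iff_lower_of_facts_noL20 W p hKatoS hDel hGZK hmod hmodD hKatoχ hr hX
      hsurj hcov).mpr hlow)

/-- **THE CHAIN OF RECORD FOR X4 ∧ `r = 0` AT EVERY ODD `p`, WITHOUT `hL20`: `BSD(E,p)` on the
covered locus when `#Ш_an(E)` is a `p`-unit** — from FOUR named published facts (`hKatoS`, `hDel`,
`hmodD`, `hKatoχ`) + GZK + modularity. [cite: Kato2004Asterisque, Thm. 14.5 (3) (p. 236), Thm. 17.4 (3) (p. 273)]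
[cite: Delbourgo1998, Prop. 4 (p. 144)] [cite: Miller2011LMS, §1 and Def. 1.1] -/
theorem X4RankZero.bsdp_of_facts_of_shaAn_unit_noL20
    (hKatoS : Kato2004.rankZero_padicValNat_sha_le_sub_localTamagawa_of_additive_potGood_of_imageContainsSL2)
    (hDel : Delbourgo1998.prop4_rankZero_pow_dvd_constantCoeff)
    (hGZK : rank_eq_analyticRank_of_analyticRank_le_one) (hmod : hasEntireLFunction_rat)
    (hmodD : nonempty_modularParametrizationData)
    (hKatoχ : Wuthrich2014.kato_halfEigenCharIdeal_dvd_cyclotomicPrime_of_surjective)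
    (hr : W.analyticRank = 0) (hX : ClassX4 W p) (hsurj : Surj W p)
    (hcov : padicValRat p W.j < 0 ∨
      ((∀ n : ℕ, W.HasSurjectiveModNGaloisRep (p ^ n : ℕ)) ∧
        padicValNat p W.tamagawaProduct =
          padicValNat p ((W.baseChange ℚ_[p]).localTamagawaNumber ℤ_[p]) ∧
        ∃ (N : ℕ) (_ : NeZero N) (D : ModularParametrizationData W N), ¬ (p : ℤ) ∣ D.maninConstant))
    {q : ℚ} (hq : shaAn W = (q : ℂ)) (hv : padicValRat p q = 0) : BSDp W p :=
  bsdp_of_missingPPartAt W p hGZK (by rw [hr]; exact zero_le_one)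
    (missingPPartAt_of_upper_of_shaAn_unit W p
      (X4RankZero.missingUpperBoundAt_of_facts_noL20 W p hKatoS hDel hGZK hmod hmodD hKatoχ hr hX hsurj
        hcov) hq hv)

end Summit.BirchSwinnertonDyer.Rank1Residual.Additive

end
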